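import Literature.MathematicalPhysics.QuantumFieldTheory.Balaban1985CMP102.Setting
import Literature.MathematicalPhysics.QuantumFieldTheory.Balaban1985CMP102.SectD

/-!
# Bałaban CMP 102 (1985) 255–275, AS-PRINTED SPINE — `Theorems`: Theorem 1 (p. 257 = PDF 3 L4–7) over the concrete
# d = 3 carriers of `…Balaban1985CMP102.Setting`, in the literal reading and in the compact-coupling-window reading, with
# the uniformity clause of (3)

Source: T. Bałaban, *Ultraviolet stability of three-dimensional lattice pure gauge field theories*, Commun. Math. Phys.
**102** (1985) 255–275 [Balaban1985UV3] ([B10]; `paper:balaban1985-cmp102-uv-stability-3d`; PDF page = journal page −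
254; p. 257 read on the render `run/shared/lean/pub/pub-balaban/b2b-balaban-ref1/pages/1985-cmp102-uv-stability-3d/
…-p003-x2.png`, text-layer line numbers of `p0003.txt`).

HONEST FRAMING (lane pub-balaban3d PLAN.md §0).  Theorem 1 is typed here as a PROPOSITION-VALUED FUNCTION of a
`Construction` of the run objects (`Setting.RunObjects`: `E`, `ε₁`, the averaging `Ū` and the transformation `T` of [4],
the minimal configurations `U_k` of [7]) for every gauge group as printed (`Setting.GroupModel`) and every lattice
approximation (`Setting.Scales L`).  Print CLAIMS it at ONE construction — its own ((10)+(15) of [4] = [Balaban1985Averaging]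
p. 19, Thm 1 of [7] = [Balaban1985Variational] p. 279, `E` by (62) p. 271/(64) p. 273, `ε₁` by (7) p. 257) — which the
lane's carrier seat builds (PLAN §3.1 p1); nothing is asserted in this file.  The two readings are the 4D cell's
`…Balaban1983to89.B10.Thm1Printed` (literal) and `B10.Thm1PrintedCompact` (compact coupling window) BY NAME on the family
`S ↦ (mk G 𝔊 S).toRunData` of ALL lattice approximations; RECORDED NEGATIVE KNOWLEDGE (cell pub-balaban GAPS G-B10-01,
SERIES.md §1 B10 v4.24, PLAN §0.4): the literal reading is kernel-false on the paper's own leaf system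
(`…B10DagLeaf.not_thm1Printed_of_leafSystems` — by (62) p. 271 `−E` contains `d(𝔤)|T₁^{(j)*}| log g_j^{−1}`, unbounded per
site as ε → 0), the compact reading is certified from the 25 printed leaves (`…B10Assembly.thm1Compact_and_thm2_of_leafSystem`)
and is the lane's end-theorem target; the negative edge is instantiated for these carriers in `…Balaban1985CMP102.SectB`
(it needs the `TowerRun` level of the inductive hypothesis (41)/(47)).  Theorem 2 (p. 272) is `…SectD.Thm2AsPrinted` (a
`RunData`-family statement); its `Construction`-level wrapper `Thm2AsPrintedC` is here.

THE FAMILY AND ε₀ (lane ruling R-EPS0′, READING R-ε₀ of PLAN §0.4).  p. 256 = PDF 2 L15–18: «We terminate constructions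
of the densities ρ_k when we reach the unit lattice, or more exactly when L^kε = ε₀, where ε₀ is a positive constant
depending on the coupling constant g only. Let us denote by K the index satisfying this equality, i.e. L^Kε = ε₀.
Obviously K depends on ε and ε₀.» ⟦reading: «ε₀ … depending on the coupling constant g only» ↦ `∃ eps0 : ℝ → ℝ`
(positive on positive couplings) chosen by the construction, AFTER the model binders (the group) and BEFORE the family;
the family of lattice approximations Theorem 1 / (3) / Theorem 2 speak about = ALL `S : Scales L` (all g, ε, K,
volumes) with `S.ε₀ = eps0 S.g` (`Family L eps0`; `=` as printed: one ε₀ per g)⟧.  The thresholds «for g_{k−1}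
sufficiently small» (p. 267 L9), «for g_j sufficiently small» (p. 273) that the leaves need are then met by the choice
of `eps0` (g_K = gε₀^{1/2}; the lane's end theorem exhibits it); `Scales.gK_le_one` stays as the normalisation
g_K ≤ 1 (LQB `B10Assembly.LeafSystem.g_le_one`).
-/

namespace Literature.MathematicalPhysics.QuantumFieldTheory.Balaban1985CMP102.Theorems

open Literature.MathematicalPhysics.QuantumFieldTheory.Balaban1983to89
open Literature.MathematicalPhysics.QuantumFieldTheory.Balaban1985CMP102.Setting

/-- A CONSTRUCTION of the run objects: for every gauge group as printed (`GroupModel`) and every lattice approximation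
(`Scales L`: ε, K with L^Kε = ε₀, volume, coupling g), the objects (1)–(6) of p. 256 — `E` «defined … during the proof»
(L5–8), `T` «described in [1, 4]» (L9–10), `U_k` «constructed in [7]» (L35), `ε₁` «chosen later» (L27).  Print's
construction is ONE such `mk`; the propositions below are functions of `mk`, claimed by print only at that one.  (`L` — the
block size of [4] — and `G` are fixed across the family, as in print.) [cite: Balaban1985UV3, (1)–(6) pp.256–257] -/
def Construction (L : ℕ) : Type 1 :=
  ∀ (G : Type) [Balaban1983to89.GaugeGroup G] [MeasurableSpace G] [Balaban1983to89.HaarData G],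
    GroupModel G → ∀ S : Scales L, RunObjects S G

/-- THE FAMILY at terminal spacing `ε₀ = eps0(g)`: p. 256 = PDF 2 L15–18 «when L^kε = ε₀, where ε₀ is a positive
constant depending on the coupling constant g only. Let us denote by K the index satisfying this equality, i.e. L^Kε =
ε₀.» — all lattice approximations `S : Scales L` (all couplings g, spacings ε, step numbers K with L^Kε = ε₀, volumes)
whose terminal spacing is the one the construction chose for their coupling ⟦reading R-ε₀: `S.ε₀ = eps0 S.g`⟧. [cite: Balaban1985UV3, p.256 L15–18] -/
abbrev Family (L : ℕ) (eps0 : ℝ → ℝ) : Type :=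
  {S : Scales L // S.ε₀ = eps0 S.g}

/-- The `B10.RunData` family of a construction `mk` (group `G` as printed) at terminal spacing `eps0`:
`S ↦ (mk G 𝔊 S).toRunData` on `Family L eps0`. [cite: Balaban1985UV3, (1)–(5) p.256] -/
noncomputable abbrev runs {L : ℕ} (mk : Construction L) (G : Type) [Balaban1983to89.GaugeGroup G] [MeasurableSpace G]
    [Balaban1983to89.HaarData G] (𝔊 : GroupModel G) (eps0 : ℝ → ℝ) : Family L eps0 → Balaban1983to89.B10.RunData :=
  fun S => (mk G 𝔊 S.1).toRunData

/-- **THEOREM 1** p. 257 = PDF 3 L4–7, verbatim: «Theorem 1. The lattice approximations of the three-dimensional pure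
Yang–Mills theory with a semi-simple compact group Lie G are ultraviolet stable in the sense that the sequence of densities
ρ_k, constructed by the inductive definition (2), with ρ₀ given by (1), satisfies the bounds (5).» together with p. 257 L1
(first text line under the running head) «and the constant O(1) is independent of ε, k, g_k in a bounded set.» and the
family clause p. 256 L15–18 «when L^kε = ε₀, where ε₀ is a positive constant depending on the coupling constant g only»
— the LITERAL reading = the 4D cell's `B10.Thm1Printed` BY NAME on the family `Family L eps0` of the construction `mk`
with a group as printed, for SOME positive terminal-spacing function `eps0` ⟦reading R-ε₀: «∀ model, ∃ eps0, ∀ S» is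
the printed order — ε₀ depends on g (and silently on the fixed L, G)⟧: for every bound `gmax` ONE constant `O1` serves
every approximation of the family whose couplings satisfy `0 < g_k ≤ gmax` (k ≤ K), at every `k ≤ K`.
Hypotheses-as-binders: «three-dimensional» = `Params.d = 3` inside `Scales.P`; «pure Yang–Mills … ρ₀ given by (1)» =
`RunObjects.rho0`; «inductive definition (2)» = `RunObjects.rho`; «semi-simple compact group Lie G» (⊂ U(N), [4] p. 18)
= `𝔊 : GroupModel G`.  RECORDED NEGATIVE KNOWLEDGE: kernel-false on the paper's own leaf system
(`…B10DagLeaf.not_thm1Printed_of_leafSystems`, G-B10-01); the reading that holds is `Thm1AsPrintedCompact`.  Typed,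
not asserted. [cite: Balaban1985UV3, Thm 1 p.257] -/
def Thm1AsPrinted {L : ℕ} (mk : Construction L) : Prop :=
  ∀ (G : Type) [Balaban1983to89.GaugeGroup G] [MeasurableSpace G] [Balaban1983to89.HaarData G] (𝔊 : GroupModel G),
    ∃ eps0 : ℝ → ℝ, (∀ g : ℝ, 0 < g → 0 < eps0 g) ∧ Balaban1983to89.B10.Thm1Printed (runs mk G 𝔊 eps0)

/-- **THEOREM 1, compact-coupling-window reading** (same printed text p. 257 = PDF 3 L4–7 with L1, p. 256 L15–18, and
p. 256 = PDF 2 L28 «The constant O(1) goes to ∞ as g → 0»): the 4D cell's `B10.Thm1PrintedCompact` BY NAME on the same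
family `Family L eps0`, same `∃ eps0` prefix — for every window `[gmin, gmax] ⊂ (0, ∞)` ONE `O1` serves all
approximations of the family and all steps `k ≤ K` whose `g_k` lies in the window.  This is the reading certified from
the printed leaves (`…B10Assembly.thm1Compact_and_thm2_of_leafSystem`) and the lane's end-theorem target (PLAN §0.5 E4;
the end theorem EXHIBITS `eps0`).  Typed, not asserted. [cite: Balaban1985UV3, Thm 1 p.257] -/
def Thm1AsPrintedCompact {L : ℕ} (mk : Construction L) : Prop :=
  ∀ (G : Type) [Balaban1983to89.GaugeGroup G] [MeasurableSpace G] [Balaban1983to89.HaarData G] (𝔊 : GroupModel G),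
    ∃ eps0 : ℝ → ℝ, (∀ g : ℝ, 0 < g → 0 < eps0 g) ∧ Balaban1983to89.B10.Thm1PrintedCompact (runs mk G 𝔊 eps0)

/-- **(3) with its uniformity clause**, p. 256 = PDF 2 L19–24: «The ultraviolet stability means that the actions ρ_K have
bounds independent of the lattice spacing ε. … χ(U)e^{−O(1)|T_ε|} ≤ ρ_K(U) ≤ e^{O(1)|T_ε|}, |T_ε| = Σ_{x∈T_ε} ε³, (3) with
a constant O(1) depending on g and ε₀ only.», read with p. 256 L15–18 «ε₀ is a positive constant depending on the
coupling constant g only» ⟦reading R-ε₀: `∃ eps0` after the model binders⟧ — for every `g` ONE `O1` serves every lattice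
approximation of the construction with that coupling and the terminal spacing `ε₀ = eps0 g` (all ε = ε₀L^{−K}, all
volumes): `Setting.RunObjects.Bounds3`.  p. 256 L28–29: «The constant O(1) goes to ∞ as g → 0. To get a better bound we
have to write explicitly the expression divergent with g.» (that better bound is (5); (5)_K ⇒ (3) is the 4D cell's
`…B10Ineq3Terminal`).  Typed, not asserted. [cite: Balaban1985UV3, (3) p.256] -/
def UVStability3AsPrinted {L : ℕ} (mk : Construction L) : Prop :=
  ∀ (G : Type) [Balaban1983to89.GaugeGroup G] [MeasurableSpace G] [Balaban1983to89.HaarData G] (𝔊 : GroupModel G),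
    ∃ eps0 : ℝ → ℝ, (∀ g : ℝ, 0 < g → 0 < eps0 g) ∧
      ∀ g : ℝ, ∃ O1 : ℝ, ∀ S : Scales L, S.g = g → S.ε₀ = eps0 g → (mk G 𝔊 S).Bounds3 O1

/-- **THEOREM 2 at the level of a construction**: p. 272 = PDF 18 L35–36, verbatim: «Theorem 2. The sequence of densities
ρ_k defined by the inductive equations (2), with ρ₀ given by (1), satisfies the inequalities (41), (47).» — the spine's
`SectD.Thm2AsPrinted` (= the 4D cell's `B10.Thm2Printed`: every run of the family satisfies its (41)/(47) slot
`RunData.Ineq41_47 k` for `k ≤ K`; the slot is pinned to the typed displays at the `TowerRun` level, `B10.SpecOK` /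
`SectB.TowerObjects.specOK_pin`) BY NAME on the family `Family L eps0`, with the same `∃ eps0` prefix as Theorem 1
⟦reading R-ε₀⟧.  Typed, not asserted. [cite: Balaban1985UV3, Thm 2 p.272] -/
def Thm2AsPrintedC {L : ℕ} (mk : Construction L) : Prop :=
  ∀ (G : Type) [Balaban1983to89.GaugeGroup G] [MeasurableSpace G] [Balaban1983to89.HaarData G] (𝔊 : GroupModel G),
    ∃ eps0 : ℝ → ℝ, (∀ g : ℝ, 0 < g → 0 < eps0 g) ∧ SectD.Thm2AsPrinted (runs mk G 𝔊 eps0)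

/-- `Thm1AsPrinted` UNFOLDED (definitional, `Iff.rfl`): for every group as printed there is a positive `eps0` such that
for every `gmax > 0` there is `O1` such that every lattice approximation `S` with `ε₀ = eps0(g)` and `0 < g_k ≤ gmax`
for `k ≤ K` satisfies (5) = `B10.Bounds5` (whose unfolding over the concrete objects is
`Setting.RunObjects.bounds5At_toRunData_iff`). [cite: Balaban1985UV3, Thm 1 p.257] -/
theorem thm1AsPrinted_iff {L : ℕ} (mk : Construction L) :
    Thm1AsPrinted mk ↔
      ∀ (G : Type) [Balaban1983to89.GaugeGroup G] [MeasurableSpace G] [Balaban1983to89.HaarData G] (𝔊 : GroupModel G),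
        ∃ eps0 : ℝ → ℝ, (∀ g : ℝ, 0 < g → 0 < eps0 g) ∧
          ∀ gmax : ℝ, 0 < gmax → ∃ O1 : ℝ, ∀ S : Family L eps0,
            (∀ k, k ≤ S.1.K → 0 < S.1.gk k ∧ S.1.gk k ≤ gmax) →
              Balaban1983to89.B10.Bounds5 (mk G 𝔊 S.1).toRunData O1 :=
  Iff.rfl

/-- `Thm1AsPrintedCompact` UNFOLDED (definitional, `Iff.rfl`). [cite: Balaban1985UV3, Thm 1 p.257] -/
theorem thm1AsPrintedCompact_iff {L : ℕ} (mk : Construction L) :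
    Thm1AsPrintedCompact mk ↔
      ∀ (G : Type) [Balaban1983to89.GaugeGroup G] [MeasurableSpace G] [Balaban1983to89.HaarData G] (𝔊 : GroupModel G),
        ∃ eps0 : ℝ → ℝ, (∀ g : ℝ, 0 < g → 0 < eps0 g) ∧
          ∀ gmin gmax : ℝ, 0 < gmin → gmin ≤ gmax → ∃ O1 : ℝ, ∀ S : Family L eps0, ∀ k, k ≤ S.1.K →
            gmin ≤ S.1.gk k → S.1.gk k ≤ gmax → Balaban1983to89.B10.Bounds5At (mk G 𝔊 S.1).toRunData O1 k :=
  Iff.rfl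

/-- `Thm2AsPrintedC` UNFOLDED (definitional, `Iff.rfl`): the slot `RunObjects.ineq41_47 k` of every approximation of
the family holds for `k ≤ K`. [cite: Balaban1985UV3, Thm 2 p.272] -/
theorem thm2AsPrintedC_iff {L : ℕ} (mk : Construction L) :
    Thm2AsPrintedC mk ↔
      ∀ (G : Type) [Balaban1983to89.GaugeGroup G] [MeasurableSpace G] [Balaban1983to89.HaarData G] (𝔊 : GroupModel G),
        ∃ eps0 : ℝ → ℝ, (∀ g : ℝ, 0 < g → 0 < eps0 g) ∧
          ∀ S : Family L eps0, ∀ k, k ≤ S.1.K → (mk G 𝔊 S.1).ineq41_47 k :=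
  Iff.rfl

/-- The literal reading implies the compact one whenever the construction's couplings are positive and uniformly bounded
above across the family (print: `g_k ≤ g ε₀^{1/2}` per approximation) — the 4D cell's `B10.thm1Compact_of_thm1Printed` BY
NAME, with the same `eps0`; the converse fails (G-B10-01).  Re-derived bookkeeping about the two readings of Theorem 1
p. 257, no content of the paper. [cite: Balaban1985UV3, Thm 1 p.257] -/
theorem thm1AsPrintedCompact_of_thm1AsPrinted {L : ℕ} (mk : Construction L) (gtop : ℝ) (htop : 0 < gtop)
    (hg : ∀ (G : Type) [Balaban1983to89.GaugeGroup G] [MeasurableSpace G] [Balaban1983to89.HaarData G]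
      (𝔊 : GroupModel G) (S : Scales L) (k : ℕ), k ≤ S.K → 0 < S.gk k ∧ S.gk k ≤ gtop)
    (h : Thm1AsPrinted mk) : Thm1AsPrintedCompact mk := by
  intro G _ _ _ 𝔊
  obtain ⟨eps0, hpos, h1⟩ := h G 𝔊
  exact ⟨eps0, hpos, Balaban1983to89.B10.thm1Compact_of_thm1Printed _ gtop htop
    (fun S k hk => hg G 𝔊 S.1 k hk) h1⟩

end Literature.MathematicalPhysics.QuantumFieldTheory.Balaban1985CMP102.Theorems
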